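import Mathlib.NumberTheory.ArithmeticFunction.Misc
import Mathlib.Algebra.Polynomial.Eval.Defs
import Mathlib.Algebra.Polynomial.BigOperators
import Mathlib.RingTheory.Coprime.Basic
import Mathlib.Analysis.SpecialFunctions.Pow.Real
import Mathlib.RingTheory.Polynomial.Resultant.Basic
import Literature.NumberTheory.Sieve.BatemanHorn
import HarnessLib

/-!
# Nair–Tenenbaum: short sums of class-`𝓜` functions of polynomial values

M. Nair, G. Tenenbaum, *Short sums of certain arithmetic functions*, Acta Math. 180 (1998),
119–144.  For `A, B ≥ 1` and `ε > 0` the class `𝓜(A, B, ε)` (`= 𝓜₁(A, B, ε)`, op. cit. (1) and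
§2 p. 123) consists of the non-negative arithmetic functions `f` with
`f(mn) ≤ min(A^{Ω(m)}, B m^ε) f(n)` whenever `(m, n) = 1` — a hypothesis much weaker than
multiplicativity (Shiu's class, file `ShiuUniform`).  For `T ∈ ℤ[X]`, `‖T‖ := maxᵢ |cᵢ|`,
`ρ_T(n)` is the number of zeros of `T` modulo `n`, and `T` has *no fixed prime divisor* iff
`ρ_T(p) < p` for every prime `p` (§2, p. 123).

**Corollary 3** (p. 126; the pairwise-coprime case of the main Theorem 1, p. 125): *Let `k ≥ 1`
and let `Q₁, …, Q_k ∈ ℤ[X]` be pairwise coprime polynomials such that `Q = ∏ Qⱼ` has no fixed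
prime divisor; `g := deg Q`.  Then for any `A ≥ 1`, `B ≥ 1`, `0 < ε < 1/(8g²)`, `0 < δ ≤ 1` and
`Fⱼ ∈ 𝓜(A, B, ⅓εδ)` (`1 ≤ j ≤ k`),*
`∑_{x < n ≤ x+y} ∏ⱼ Fⱼ(|Qⱼ(n)|) ≪ y ∏_{p ≤ x} (1 − ρ(p)/p) ∏ⱼ ∑_{n ≤ x} Fⱼ(n) ρⱼ(n)/n`
*uniformly for `x ≥ c₀ ‖Q‖^δ` and `x^{4g²ε} ≤ y ≤ x`; the implicit constant depends at most on
`A, B, ε, δ, k, r, g, D` and `c₀` at most on `A, B, ε, δ, k, r, g`* (`r` = number of irreducible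
factors of `Q`, `D` its discriminant datum, `ρ = ρ_Q`, `ρⱼ = ρ_{Qⱼ}`).

This file REUSES the tree's `polyRootCountMod f n` (`ρ` of the product of a family `f : ι → ℤ[X]`
modulo `n`; for one polynomial: `polyRootCountMod ![T] n = ρ_T(n)`) and `HasNoFixedPrimeDivisor f`
(`ρ(p) < p` for all primes) of `Sieve/BatemanHorn`, introduces `polyHeight` and the class predicate
`IsClassM` as real definitions, and vendored Corollary 3 as the named fact
`NairTenenbaum1998_corollary3` (D-0014; unproved here) — MISSTATED, see the erratum.

## Erratum (2026-08-16): `NairTenenbaum1998_corollary3` is MISSTATED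

The first rendering, `NairTenenbaum1998_corollary3`, takes `Fⱼ ∈ 𝓜(A, B, ε)`; the PRINTED class
hypothesis of Corollary 3 — and of Theorem 1, from which it is derived — is `Fⱼ ∈ 𝓜(A, B, ⅓εδ)`
(Cor. 3, p. 126: "`Fⱼ ∈ 𝓜(A, B, ⅓εδ) (1 ≤ j ≤ k)`"; Thm 1, p. 125: "`F ∈ 𝓜_k(A, B, ⅓εδ)`";
the exponent is visible in the proof: (30) p. 133 "`G(b_{1n}, …, b_{rn}) ≤ min{A^{Ω(bₙ)}, B bₙ^{εδ/3}}`",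
p. 135 (feeding (33)) "`F(|Q₁(n)|, …) ≤ G(…) ≤ B|Q(n)|^{εδ/3}`"; Henriot 2012, Thm 1 restates it as
"`ε ≤ αδ/(12g²)`, `F ∈ 𝓜_k(A, B, ε)`, `x^α < y`", i.e. exponent `⅓ε′δ` for `α = 4g²ε′`).  Since
`𝓜(A, B, ⅓εδ) ⊊ 𝓜(A, B, ε)`, the first rendering quantifies over a LARGER class at the SAME
interval length `y ≥ x^{4g²ε}` and is strictly stronger than anything printed (covering
`𝓜(A, B, ε)` by the printed corollary forces `ε′ ≥ 3ε/δ′ > 3ε`, hence `y ≥ x^{12g²ε}`); it is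
not a reparametrisation and no published proof covers it.  The faithful statement is spelled
out, as a conclusion, in the proved `NairTenenbaum1998_corollary3.printedForm` (the old Prop
implies it; an erratum written by a proving seat may not vendor a new named fact, D-0026, so the
corrected NAMED fact `NairTenenbaum1998_corollary3_printed := <that conclusion>` is left to a
definition proposal).  The old declaration is kept verbatim (the ledger refers to it) and
flagged in its docstring.

## Erratum 2 (2026-08-16): `NairTenenbaum1998_theorem1` is MISSTATED (parameter range)

`NairTenenbaum1998_theorem1` transcribes K. Henriot's paraphrase of the main theorem (Henriot 2012,
Thm. 1: "`0 < α < 1`, `0 < δ < 1`, `ε ≤ αδ/(12g²)`, `F ∈ 𝓜_k(A, B, ε)`, `x^α < y ≤ x`"), which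
Henriot QUOTES and does not prove.  The PRINTED Theorem 1 (Acta Math. 180, p. 125) reads "for any
`A ≥ 1`, `B ≥ 1`, `0 < ε < 1/8g²`, `0 < δ < 1` and `F ∈ 𝓜_k(A, B, ⅓εδ)` … uniformly for
`x ≥ c₀‖Q‖^δ` and `x^{4g²ε} ≤ y ≤ x`".  Under the dictionary `α = 4g²ε_NT` (class exponent
`⅓ε_NT δ = αδ/(12g²)`) the printed hypothesis `ε_NT < 1/(8g²)` is `α < 1/2`, NOT `α < 1`.  For
`α ∈ [1/2, 1)` the tree's Prop admits class exponents `ε ∈ [δ/(24g²), αδ/(12g²)]` in the range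
`x ≥ c₀‖Q‖^δ`, whereas the printed theorem reaches a class exponent `⅓ε_NT δ_NT ≥ δ/(24g²)` only
with `δ_NT > δ`, i.e. in the SMALLER range `x ≥ c₀‖Q‖^{δ_NT}` (`‖Q‖` is unbounded at fixed degree
and discriminant, e.g. `Q = X + a`, so the two ranges are not comparable up to constants), and the
class exponent cannot be traded against `B` (take `m = 2^v` in (1)).  Henriot's own Theorem 5 /
Corollary 1 (proved there, for all `0 < α < 1`) requires `ε < α/(50g(g + 1/δ))`, which is
`< αδ/(12g²)` whenever `g ≤ 4`; it does not cover the gap either (e.g. `k = g = 1`, `α = 9/10`,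
`δ = 1/2`, `ε = αδ/12`: Henriot needs `ε < 3/500`, Nair–Tenenbaum a class exponent `< 1/48`, the
Prop claims `ε = 3/80`).  So the Prop is stronger than every published statement on part of its
range and no published proof covers it.  The faithful statement, in Nair–Tenenbaum's own
parametrisation (same scope — pairwise coprime irreducible `Qⱼ` — and same rendering otherwise),
is spelled out as the HYPOTHESIS of the proved `NairTenenbaum1998_theorem1.henriotForm_of_printed`
(end of file; it yields Henriot's form on EXACTLY the range `0 < α < 1/2`) and, up to the strict
`x^{4g²ε} < y`, as the CONCLUSION of the proved `NairTenenbaum1998_theorem1.printedForm_strict`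
(the old Prop implies it, i.e. is the stronger of the two).  An erratum written by a proving seat
may not vendor a new named fact (D-0026), so the corrected NAMED fact
`NairTenenbaum1998_theorem1_printed := <that hypothesis, verbatim>` is left to a definition
proposal (as for Corollary 3).  The old declaration is kept verbatim (the ledger refers to it)
and flagged in its docstring.

## Rendering choices (what a reviewer must accept)

* Quantifier order renders the dependence of the constants: `c₀` is chosen after
  `(k, g, A, B, ε, δ)` only — legitimate since the printed `c₀(A, B, ε, δ, k, r, g)` can be
  maximised over the finitely many `r ≤ g`; the `≪`-constant `C` is chosen after `Q` (the source
  lets it depend on `Q` only through `r` and `D`; allowing all of `Q` is WEAKER than printed —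
  `TODO(general form)`: dependence through `(r, D)` only, needs the discriminant of `Q*`).
* "Pairwise coprime polynomials" = coprime in `ℚ[X]` (`IsCoprime` of the images); `δ < 1`
  (the corollary prints `δ ≤ 1`, Theorem 1 prints `δ < 1`; the narrower range is weaker).
* The at most `g` integers `n` with `Q(n) = 0`, for which `Fⱼ(|Qⱼ(n)|) = Fⱼ(0)` is meaningless
  in the source (arithmetic functions live on `ℤ⁺`), are omitted from the left-hand sum.
* `x < n ≤ x + y` is `n ∈ Ioc ⌊x⌋₊ ⌊x+y⌋₊` (`x ≥ 0` in the range considered); `p ≤ x`, `n ≤ x`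
  are `Icc 1 ⌊x⌋₊`.  `‖Q‖ = 0` only for `Q = 0`, which has every prime as fixed divisor.
* NOT vendored: the discriminant-uniform refinement of K. Henriot, Math. Proc. Camb. Phil.
  Soc. 152 (2012), Thm. 3 / Thm. 5 (constants free of `D` at the price of a factor `Δ_D` and the
  restriction `(n₁⋯n_k, D) = 1`, shown optimal there) — the paraphrase "uniform constants and no
  `Δ_D`" is not a theorem. [Henriot2012]

## References

* [NairTenenbaum1998] M. Nair, G. Tenenbaum, Acta Math. 180 (1998): (1) p. 119; §2 p. 123
  (`ρ`, fixed prime divisor, `‖T‖`, `𝓜_k(A, B, ε)`); Theorem 1 p. 125; Corollary 3 p. 126.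
* [Henriot2012] K. Henriot, *Nair–Tenenbaum bounds uniform with respect to the discriminant*,
  Math. Proc. Cambridge Philos. Soc. 152 (2012), 405–424 (arXiv:1102.1643), Thm. 1 (restatement
  of Nair–Tenenbaum), Thm. 3–5; Thm. 5 / Cor. 1, p. 7 of the arXiv version (`ε < α/(50g(g+1/δ))`).
* [Shiu1980] P. Shiu, J. reine angew. Math. 313 (1980), Thm. 1 (tree: `ShiuUniform`).
-/

noncomputable section

open Polynomial Finset Real
open scoped ArithmeticFunction.Omega

namespace Literature.NumberTheory.Sieve

/-! ### Vocabulary -/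

/-- The **height** `‖T‖ = maxᵢ |cᵢ|` of an integer polynomial `T = ∑ cᵢ Xⁱ` (Nair–Tenenbaum
§2, p. 123: "`‖T‖ := maxᵢ |cᵢ|`"); `0` for `T = 0`. [cite: NairTenenbaum1998, §2 p. 123] -/
def polyHeight (T : ℤ[X]) : ℕ :=
  T.support.sup fun i => (T.coeff i).natAbs

/-- **Nair–Tenenbaum's class `𝓜(A, B, ε)`** (`= 𝓜₁(A, B, ε)`, op. cit. (1) with `k = 1` and §2
p. 123–124): `f ≥ 0` and `f(mn) ≤ min(A^{Ω(m)}, B m^ε) · f(n)` for all coprime `m, n ≥ 1`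
(`Ω` = number of prime factors with multiplicity, Mathlib `ArithmeticFunction.cardFactors`).
Every non-negative multiplicative `f` with `f(p^l) ≤ A^l` and `f(m) ≤ B m^ε` is in the class.
[cite: NairTenenbaum1998, (1) p. 119 and §2 p. 123] -/
def IsClassM (A B ε : ℝ) (f : ℕ → ℝ) : Prop :=
  (∀ n, 0 ≤ f n) ∧
    ∀ m n : ℕ, 1 ≤ m → 1 ≤ n → m.Coprime n →
      f (m * n) ≤ min (A ^ (Ω m)) (B * (m : ℝ) ^ ε) * f n

/-- A non-negative function of Shiu's type (`f(mn) = f(m) f(n)` for coprime `m, n`,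
`f(m) ≤ A^{Ω(m)}` and `f(m) ≤ B m^ε` for `m ≥ 1`) lies in `𝓜(A, B, ε)`. [cite: NairTenenbaum1998, §1 p. 119] -/
theorem isClassM_of_mul_of_le {A B ε : ℝ} {f : ℕ → ℝ} (h0 : ∀ n, 0 ≤ f n)
    (hmul : ∀ m n : ℕ, m.Coprime n → f (m * n) = f m * f n)
    (hA : ∀ m : ℕ, 1 ≤ m → f m ≤ A ^ (Ω m)) (hB : ∀ m : ℕ, 1 ≤ m → f m ≤ B * (m : ℝ) ^ ε) :
    IsClassM A B ε f := by
  refine ⟨h0, fun m n hm _ hmn => ?_⟩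
  rw [hmul m n hmn]
  exact mul_le_mul_of_nonneg_right (le_min (hA m hm) (hB m hm)) (h0 n)

/-! ### The theorem (named fact) -/

/-- **MISSTATED — stronger than the source** (erratum in the module docstring): the printed
class hypothesis is `Fⱼ ∈ 𝓜(A, B, ⅓εδ)`, not `𝓜(A, B, ε)`; the faithful statement is the
conclusion of `NairTenenbaum1998_corollary3.printedForm` below (implied by this Prop).  Kept
verbatim for the ledger.

Nair–Tenenbaum 1998, Corollary 3 with the class `𝓜(A, B, ε)` (NOT as printed).  For all
`k ≥ 1`, `g`, `A ≥ 1`, `B ≥ 1`, `0 < ε < 1/(8g²)`, `0 < δ < 1` there is `c₀` such that for all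
pairwise coprime `Q₁, …, Q_k ∈ ℤ[X]` (coprime in `ℚ[X]`) with `Q = ∏ Qⱼ` of degree `g` and
without fixed prime divisor there is `C ≥ 0` such that for all `F₁, …, F_k ∈ 𝓜(A, B, ε)` (printed:
`𝓜(A, B, ⅓εδ)`) and all `x, y` with `x ≥ c₀ ‖Q‖^δ`, `x^{4g²ε} ≤ y ≤ x`:
`∑_{x < n ≤ x+y, Q(n) ≠ 0} ∏ⱼ Fⱼ(|Qⱼ(n)|) ≤ C · y · ∏_{p ≤ x} (1 − ρ_Q(p)/p) · ∏ⱼ ∑_{1 ≤ n ≤ x} Fⱼ(n) ρ_{Qⱼ}(n)/n`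
(`ρ_Q(p) = polyRootCountMod Q p`, `ρ_{Qⱼ}(n) = polyRootCountMod ![Q j] n`, `‖Q‖ = polyHeight (∏ Qⱼ)`).
Printed: "uniformly for `x ≥ c₀‖Q‖^δ` and `x^{4g²ε} ≤ y ≤ x`.  The dependencies of the various
constants are as described in the statement of Theorem 1" (implicit constant: `A, B, ε, δ, k, r,
g, D`; `c₀`: `A, B, ε, δ, k, r, g`) — see the module docstring for the (weaker) rendering of
these dependencies and the omission of the `≤ g` roots of `Q` from the left sum.
A NAMED FACT, not proved in the tree; NOT a published theorem as it stands (class exponent).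
[cite: NairTenenbaum1998, Corollary 3 (p. 126) — with the class hypothesis misread, see above] -/
def NairTenenbaum1998_corollary3 : Prop :=
  ∀ (k g : ℕ) (A B ε δ : ℝ), 1 ≤ k → 1 ≤ A → 1 ≤ B → 0 < ε → ε < 1 / (8 * (g : ℝ) ^ 2) →
    0 < δ → δ < 1 →
    ∃ c₀ : ℝ, ∀ Q : Fin k → ℤ[X],
      (∀ i j, i ≠ j → IsCoprime ((Q i).map (Int.castRingHom ℚ)) ((Q j).map (Int.castRingHom ℚ))) →
      HasNoFixedPrimeDivisor Q → (∏ j, Q j).natDegree = g →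
      ∃ C : ℝ, 0 ≤ C ∧ ∀ F : Fin k → ℕ → ℝ, (∀ j, IsClassM A B ε (F j)) →
        ∀ x y : ℝ, c₀ * (polyHeight (∏ j, Q j) : ℝ) ^ δ ≤ x → x ^ (4 * (g : ℝ) ^ 2 * ε) ≤ y → y ≤ x →
          ∑ n ∈ (Finset.Ioc ⌊x⌋₊ ⌊x + y⌋₊).filter (fun n : ℕ => (∏ j, Q j).eval (n : ℤ) ≠ 0),
              ∏ j, F j (((Q j).eval (n : ℤ)).natAbs) ≤
            C * y * (∏ p ∈ (Finset.Icc 1 ⌊x⌋₊).filter Nat.Prime,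
                (1 - (polyRootCountMod Q p : ℝ) / p)) *
              ∏ j, ∑ n ∈ Finset.Icc 1 ⌊x⌋₊, F j n * (polyRootCountMod ![Q j] n : ℝ) / n

/-! ### Erratum: Corollary 3 as printed (class `𝓜(A, B, ⅓εδ)`) -/

/-- Monotonicity of the class `𝓜(A, B, η)` in the exponent: for `B ≥ 0` and `η ≤ η'`,
`𝓜(A, B, η) ⊆ 𝓜(A, B, η')` (as `m^η ≤ m^{η'}` for `m ≥ 1`). [folklore] -/
theorem IsClassM.mono {A B η η' : ℝ} {f : ℕ → ℝ} (hB : 0 ≤ B) (hη : η ≤ η')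
    (hf : IsClassM A B η f) : IsClassM A B η' f := by
  refine ⟨hf.1, fun m n hm hn hmn => (hf.2 m n hm hn hmn).trans ?_⟩
  refine mul_le_mul_of_nonneg_right (min_le_min le_rfl ?_) (hf.1 n)
  exact mul_le_mul_of_nonneg_left
    (Real.rpow_le_rpow_of_exponent_le (by exact_mod_cast hm) hη) hB

/-- **Nair–Tenenbaum 1998, Corollary 3 AS PRINTED**, as a consequence of the (stronger,
misstated) `NairTenenbaum1998_corollary3`.  Printed (p. 126): "Let `k` be an arbitrary positive
integer and let `Qⱼ ∈ ℤ[X]` (`1 ≤ j ≤ k`) be pairwise coprime polynomials.  Assume that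
`Q = ∏ⱼ Qⱼ` has no fixed prime divisor.  Let `g := deg Q`.  Then for any `A ≥ 1`, `B ≥ 1`,
`0 < ε < 1/8g²`, `0 < δ ≤ 1` and `Fⱼ ∈ 𝓜(A, B, ⅓εδ)` (`1 ≤ j ≤ k`), we have
`∑_{x<n≤x+y} ∏ⱼ Fⱼ(|Qⱼ(n)|) ≪ y ∏_{p≤x} (1 − ρ(p)/p) ∏ⱼ ∑_{n≤x} Fⱼ(n) ρⱼ(n)/n`
uniformly for `x ≥ c₀‖Q‖^δ` and `x^{4g²ε} ≤ y ≤ x`.  The dependencies of the various constants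
are as described in the statement of Theorem 1" (implicit constant: at most `A, B, ε, δ, k, r,
g, D`; `c₀`: at most `A, B, ε, δ, k, r, g`).  The CONCLUSION of this theorem is the faithful
rendering of that statement: identical to `NairTenenbaum1998_corollary3` (same "Rendering
choices", module docstring: `c₀` after `(k, g, A, B, ε, δ)` — legitimate as `r ≤ g`; `C` after
`Q` — weaker than printed; `0 < δ < 1` — the range of Theorem 1, from which the corollary is
derived, weaker than the corollary's `δ ≤ 1`; coprimality in `ℚ[X]`; the `≤ g` roots of `Q`
omitted from the left sum) EXCEPT for the class hypothesis, which is the printed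
`Fⱼ ∈ 𝓜(A, B, ⅓εδ)`, i.e. `IsClassM A B (ε * δ / 3) (F j)`.  It is the statement a definition
proposal should vendor verbatim as the named fact `NairTenenbaum1998_corollary3_printed` (whose
proof is the whole of op. cit. §4); here it is only DERIVED from the old Prop, by
`𝓜(A, B, ⅓εδ) ⊆ 𝓜(A, B, ε)` (`IsClassM.mono`), which shows the old Prop to be the stronger one.
[cite: NairTenenbaum1998, Corollary 3 (p. 126); class exponent: Theorem 1 (p. 125), (30) p. 133] -/
theorem NairTenenbaum1998_corollary3.printedForm (h : NairTenenbaum1998_corollary3) :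
    ∀ (k g : ℕ) (A B ε δ : ℝ), 1 ≤ k → 1 ≤ A → 1 ≤ B → 0 < ε → ε < 1 / (8 * (g : ℝ) ^ 2) →
    0 < δ → δ < 1 →
    ∃ c₀ : ℝ, ∀ Q : Fin k → ℤ[X],
      (∀ i j, i ≠ j → IsCoprime ((Q i).map (Int.castRingHom ℚ)) ((Q j).map (Int.castRingHom ℚ))) →
      HasNoFixedPrimeDivisor Q → (∏ j, Q j).natDegree = g →
      ∃ C : ℝ, 0 ≤ C ∧ ∀ F : Fin k → ℕ → ℝ, (∀ j, IsClassM A B (ε * δ / 3) (F j)) →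
        ∀ x y : ℝ, c₀ * (polyHeight (∏ j, Q j) : ℝ) ^ δ ≤ x → x ^ (4 * (g : ℝ) ^ 2 * ε) ≤ y → y ≤ x →
          ∑ n ∈ (Finset.Ioc ⌊x⌋₊ ⌊x + y⌋₊).filter (fun n : ℕ => (∏ j, Q j).eval (n : ℤ) ≠ 0),
              ∏ j, F j (((Q j).eval (n : ℤ)).natAbs) ≤
            C * y * (∏ p ∈ (Finset.Icc 1 ⌊x⌋₊).filter Nat.Prime,
                (1 - (polyRootCountMod Q p : ℝ) / p)) *
              ∏ j, ∑ n ∈ Finset.Icc 1 ⌊x⌋₊, F j n * (polyRootCountMod ![Q j] n : ℝ) / n := by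
  intro k g A B ε δ hk hA hB hε hεg hδ hδ1
  obtain ⟨c₀, hc₀⟩ := h k g A B ε δ hk hA hB hε hεg hδ hδ1
  refine ⟨c₀, fun Q hcop hfix hdeg => ?_⟩
  obtain ⟨C, hC0, hC⟩ := hc₀ Q hcop hfix hdeg
  refine ⟨C, hC0, fun F hF x y hx hy hyx =>
    hC F (fun j => (hF j).mono (by linarith) ?_) x y hx hy hyx⟩
  nlinarith [mul_nonneg hε.le (show (0 : ℝ) ≤ 3 - δ by linarith)]

/-! ### Theorem 1 (general `F ∈ 𝓜_k`; uniform in the degree and the discriminant)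

The main Theorem 1 (p. 125), in the wording of K. Henriot, Math. Proc. Camb. Phil. Soc. 152 (2012),
Thm. 1, for pairwise coprime irreducible `Qⱼ` — the case `r = k`, `Q = Q*` squarefree, where the
quantity `v(n; F, ρ)` of (16) is the restricted convolution `∑†_{n₁⋯n_k = n} F(n₁,…,n_k) ∏ ρ_{Qⱼ}(nⱼ)/nⱼ`,
dominated (dropping the dagger's coprimality restrictions, all terms being `≥ 0`) by the plain sum
typed below — and KEEPING THE PRINTED UNIFORMITY: the implicit constant depends at most on
`(A, B, ε, δ, k, r, g, D)` (p. 125; Henriot: `g, D, α, δ, A, B`) and `c₀` at most on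
`(A, B, ε, δ, k, r, g)`, with `D` the discriminant datum of `Q` (a function of `disc Q* = disc Q`,
Mathlib `Polynomial.discr`, and of the finitely many `ρ(p)`, `p ∣ disc Q` — so a constant chosen
after `disc Q` may be maximised over them).  Parametrisation: Henriot's `ε ≤ αδ/(12g²)`,
`F ∈ 𝓜_k(A, B, ε)`, `x^α < y ≤ x` is Nair–Tenenbaum's `F ∈ 𝓜_k(A, B, ε′δ/3)`, `0 < ε′ < 1/(8g²)`,
`x^{4g²ε′} ≤ y ≤ x` with `α = 4g²ε′` — so that `ε′ < 1/(8g²)` is `α < 1/2`: the `α < 1` of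
`NairTenenbaum1998_theorem1` OVER-CLAIMS, see Erratum 2 of the module docstring and
`NairTenenbaum1998_theorem1.henriotForm_of_printed`.  This is the `TODO(general form)` of the module docstring in
the squarefree case; `isClassMk_prod` records that products of class-`𝓜` functions are of class
`𝓜_k(A, B^k, ε)` (p. 121: "`F(n₁, n₂) = F₁(n₁)F₂(n₂)` lies in `𝓜₂(A, B², ε)`"). -/

/-- **Nair–Tenenbaum's class `𝓜_k(A, B, ε)`** of non-negative functions of `k` positive-integer
variables (op. cit. (1) p. 119): `F(m₁n₁, …, m_kn_k) ≤ min(A^{Ω(m)}, B m^ε) F(n₁, …, n_k)`,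
`m := m₁⋯m_k`, "for all `k`-tuples `(m₁, …, m_k)`, `(n₁, …, n_k)` with `(mⱼ, nⱼ) = 1` (`1 ≤ j ≤ k`)".
For `k = 1` this is `IsClassM` up to `ℕ ≃ (Fin 1 → ℕ)`; values at tuples with a zero coordinate are
unconstrained (never summed). [cite: NairTenenbaum1998, (1) p. 119] -/
def IsClassMk (k : ℕ) (A B ε : ℝ) (F : (Fin k → ℕ) → ℝ) : Prop :=
  (∀ n, 0 ≤ F n) ∧
    ∀ m n : Fin k → ℕ, (∀ j, 1 ≤ m j) → (∀ j, 1 ≤ n j) → (∀ j, (m j).Coprime (n j)) →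
      F (fun j => m j * n j) ≤ min (A ^ (Ω (∏ j, m j))) (B * ((∏ j, m j : ℕ) : ℝ) ^ ε) * F n

/-- Products of class-`𝓜(A, B, ε)` functions are of class `𝓜_k(A, B^k, ε)` (for `A ≥ 1`, `B ≥ 0`;
p. 121: "`F₁, F₂ ∈ 𝓜(A, B, ε)`, so that `F(n₁, n₂) = F₁(n₁)F₂(n₂)` lies in `𝓜₂(A, B², ε)`").
[cite: NairTenenbaum1998, §1 p. 121] -/
theorem isClassMk_prod {k : ℕ} {A B ε : ℝ} (hA : 1 ≤ A) (hB : 0 ≤ B) {F : Fin k → ℕ → ℝ}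
    (hF : ∀ j, IsClassM A B ε (F j)) : IsClassMk k A (B ^ k) ε (fun n => ∏ j, F j (n j)) := by
  refine ⟨fun n => Finset.prod_nonneg fun j _ => (hF j).1 (n j), fun m n hm hn hmn => ?_⟩
  have h0 : ∀ j, 0 ≤ F j (n j) := fun j => (hF j).1 (n j)
  have hstep : ∀ j, F j (m j * n j) ≤ min (A ^ (Ω (m j))) (B * ((m j : ℕ) : ℝ) ^ ε) * F j (n j) :=
    fun j => (hF j).2 (m j) (n j) (hm j) (hn j) (hmn j)
  have hmin0 : ∀ j, 0 ≤ min (A ^ (Ω (m j))) (B * ((m j : ℕ) : ℝ) ^ ε) :=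
    fun j => le_min (pow_nonneg (by linarith) _) (by positivity)
  calc ∏ j, F j (m j * n j) ≤ ∏ j, min (A ^ (Ω (m j))) (B * ((m j : ℕ) : ℝ) ^ ε) * F j (n j) :=
        Finset.prod_le_prod (fun j _ => (hF j).1 _) fun j _ => hstep j
    _ = (∏ j, min (A ^ (Ω (m j))) (B * ((m j : ℕ) : ℝ) ^ ε)) * ∏ j, F j (n j) :=
        Finset.prod_mul_distrib
    _ ≤ min (A ^ (Ω (∏ j, m j))) (B ^ k * ((∏ j, m j : ℕ) : ℝ) ^ ε) * ∏ j, F j (n j) := by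
        refine mul_le_mul_of_nonneg_right (le_min ?_ ?_) (Finset.prod_nonneg fun j _ => h0 j)
        · calc ∏ j, min (A ^ (Ω (m j))) (B * ((m j : ℕ) : ℝ) ^ ε) ≤ ∏ j, A ^ (Ω (m j)) :=
                Finset.prod_le_prod (fun j _ => hmin0 j) fun j _ => min_le_left _ _
            _ = A ^ (Ω (∏ j, m j)) := by
                have hΩ : ∀ s : Finset (Fin k), Ω (∏ j ∈ s, m j) = ∑ j ∈ s, Ω (m j) := by
                  intro s
                  induction s using Finset.induction_on with
                  | empty => simp
                  | insert a s ha ih =>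
                    rw [Finset.prod_insert ha, Finset.sum_insert ha,
                      ArithmeticFunction.cardFactors_mul (by have := hm a; omega)
                        (Finset.prod_ne_zero_iff.mpr fun j _ => by have := hm j; omega), ih]
                rw [Finset.prod_pow_eq_pow_sum, hΩ]
        · calc ∏ j, min (A ^ (Ω (m j))) (B * ((m j : ℕ) : ℝ) ^ ε) ≤ ∏ j, B * ((m j : ℕ) : ℝ) ^ ε :=
                Finset.prod_le_prod (fun j _ => hmin0 j) fun j _ => min_le_right _ _
            _ = B ^ k * ((∏ j, m j : ℕ) : ℝ) ^ ε := by
                rw [Finset.prod_mul_distrib, Finset.prod_const, Finset.card_univ, Fintype.card_fin,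
                  Nat.cast_prod, ← Real.finsetProd_rpow _ _ fun j _ => Nat.cast_nonneg (m j)]

/-- **MISSTATED — stronger than the source on part of its range** (Erratum 2 in the module
docstring): the printed Theorem 1 has `0 < ε < 1/(8g²)`, `F ∈ 𝓜_k(A, B, ⅓εδ)`,
`x^{4g²ε} ≤ y ≤ x`, which in the parametrisation below (`α = 4g²ε`) is `0 < α < 1/2`; this Prop
asserts it for `0 < α < 1` (Henriot's paraphrase) and no published proof covers `α ∈ [1/2, 1)`.
The faithful statement is the hypothesis of `NairTenenbaum1998_theorem1.henriotForm_of_printed`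
(end of file), which yields this body for `α < 1/2`.  Kept verbatim for the ledger.

**Nair–Tenenbaum 1998, Theorem 1** (main theorem, p. 125), for pairwise coprime irreducible `Qⱼ`,
in the wording of Henriot 2012, Thm. 1: "Let `k ≥ 1`. Let `Q₁, …, Q_k ∈ ℤ[X]` be `k` pairwise coprime
and irreducible polynomials. Let `Q = Q₁⋯Q_k` and denote by `g` its degree and `D` its discriminant.
Let `ρ_{Qⱼ}(n)` (resp. `ρ(n)`) denote the number of zeroes of `Qⱼ` (resp. `Q`) modulo `n` for
`1 ≤ j ≤ k`. Assume `Q` has no fixed prime divisor. Let `0 < α < 1`, `0 < δ < 1`, `A ≥ 1` and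
`B ≥ 1`. Let `ε ≤ αδ/(12g²)` and `F ∈ 𝓜_k(A, B, ε)`. We have, uniformly in `x ≥ c₀‖Q‖^δ` and
`x^α < y ≤ x`,
`∑_{x<n≤x+y} F(|Q₁(n)|, …, |Q_k(n)|) ≪ y ∏_{p≤x} (1 − ρ(p)/p) ∑_{n₁⋯n_k ≤ x} F(n₁, …, n_k) ρ_{Q₁}(n₁)⋯ρ_{Q_k}(n_k)/(n₁⋯n_k)`,
where `c₀` depends at most on `g, α, δ, A, B` and the implicit constant depends at most on
`g, D, α, δ, A, B`."  Rendering (what a reviewer must accept): `c₀` and `C` are chosen after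
`(k, g, D, A, B, α, δ, ε)` and BEFORE `Q`, `F`, `x`, `y` (`k = r ≤ g`; letting them depend on `ε` too
is Nair–Tenenbaum's own list, weaker than Henriot's); "irreducible" is `Irreducible` in `ℤ[X]`;
"pairwise coprime" = `IsCoprime` of the images in `ℚ[X]`; `D = (∏ Qⱼ).discr`;
`‖Q‖ = polyHeight (∏ Qⱼ)`; the `≤ g` roots of `Q` are omitted from the left sum (as in
`NairTenenbaum1998_corollary3`); `∑_{n₁⋯n_k ≤ x}` runs over `nⱼ ≥ 1` with `∏ nⱼ ≤ ⌊x⌋₊`.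
A NAMED FACT, not proved in the tree; NOT a published theorem as it stands (range `α < 1`, see
above). [cite: NairTenenbaum1998, Theorem 1 (p. 125) — via Henriot2012 Thm. 1, range over-claimed] -/
def NairTenenbaum1998_theorem1 : Prop :=
  ∀ (k g : ℕ) (D : ℤ) (A B α δ ε : ℝ), 1 ≤ k → 1 ≤ A → 1 ≤ B → 0 < α → α < 1 → 0 < δ → δ < 1 →
    0 < ε → ε ≤ α * δ / (12 * (g : ℝ) ^ 2) →
    ∃ c₀ C : ℝ, ∀ Q : Fin k → ℤ[X], (∀ j, Irreducible (Q j)) →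
      (∀ i j, i ≠ j → IsCoprime ((Q i).map (Int.castRingHom ℚ)) ((Q j).map (Int.castRingHom ℚ))) →
      HasNoFixedPrimeDivisor Q → (∏ j, Q j).natDegree = g → (∏ j, Q j).discr = D →
      ∀ F : (Fin k → ℕ) → ℝ, IsClassMk k A B ε F →
        ∀ x y : ℝ, c₀ * (polyHeight (∏ j, Q j) : ℝ) ^ δ ≤ x → x ^ α < y → y ≤ x →
          ∑ n ∈ (Finset.Ioc ⌊x⌋₊ ⌊x + y⌋₊).filter (fun n : ℕ => (∏ j, Q j).eval (n : ℤ) ≠ 0),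
              F (fun j => ((Q j).eval (n : ℤ)).natAbs) ≤
            C * y * (∏ p ∈ (Finset.Icc 1 ⌊x⌋₊).filter Nat.Prime,
                (1 - (polyRootCountMod Q p : ℝ) / p)) *
              ∑ n ∈ (Fintype.piFinset fun _ : Fin k => Finset.Icc 1 ⌊x⌋₊).filter
                  (fun n => ∏ j, n j ≤ ⌊x⌋₊),
                F n * ∏ j, ((polyRootCountMod ![Q j] (n j) : ℝ) / (n j))

/-! ### Erratum 2: Theorem 1 as printed (`0 < ε < 1/(8g²)`, class `𝓜_k(A, B, ⅓εδ)`, `x^{4g²ε} ≤ y ≤ x`) -/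

/-- Monotonicity of the class `𝓜_k(A, B, η)` in the exponent: for `B ≥ 0` and `η ≤ η'`,
`𝓜_k(A, B, η) ⊆ 𝓜_k(A, B, η')` (as `m^η ≤ m^{η'}` for `m = m₁⋯m_k ≥ 1`). [folklore] -/
theorem IsClassMk.mono {k : ℕ} {A B η η' : ℝ} {F : (Fin k → ℕ) → ℝ} (hB : 0 ≤ B) (hη : η ≤ η')
    (hF : IsClassMk k A B η F) : IsClassMk k A B η' F := by
  refine ⟨hF.1, fun m n hm hn hmn => (hF.2 m n hm hn hmn).trans ?_⟩
  refine mul_le_mul_of_nonneg_right (min_le_min le_rfl ?_) (hF.1 n)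
  refine mul_le_mul_of_nonneg_left (Real.rpow_le_rpow_of_exponent_le ?_ hη) hB
  exact_mod_cast Finset.one_le_prod' fun j _ => hm j

/-- **Nair–Tenenbaum 1998, Theorem 1 AS PRINTED ⇒ Henriot's form on `0 < α < 1/2`.**
The HYPOTHESIS `h` of this theorem is the faithful rendering of the printed Theorem 1 (p. 125) in
the case of pairwise coprime irreducible `Qⱼ` — `k = r`, `γ_{jh} = δ_{jh}` (p. 125: "This
corresponds to the situation where the `Qⱼ` are irreducible over `ℚ` and pairwise coprime"), where
`F̃ = F`, `ρ_h = ρ_{Qⱼ}` and `v(n; F, ρ) = ∑†_{n₁⋯n_k = n} F(n₁, …, n_k) ∏ⱼ ρ_{Qⱼ}(nⱼ)/nⱼ` ((16),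
p. 124; `†`: the `nⱼ` pairwise coprime and coprime to `D*`).  Printed: "THEOREM 1. Let `k` be an
arbitrary positive integer and let `Qⱼ ∈ ℤ[X]` (`1 ≤ j ≤ k`) be such that `Q = ∏ⱼ Qⱼ` has no fixed
prime divisor.  Denote by `g` the degree of `Q`, by `r` the number of irreducible factors of `Q`
and put `ρ = ρ_Q`.  Then for any `A ≥ 1`, `B ≥ 1`, `0 < ε < 1/8g²`, `0 < δ < 1` and
`F ∈ 𝓜_k(A, B, ⅓εδ)` we have
`∑_{x<n≤x+y} F(|Q₁(n)|, …, |Q_k(n)|) ≪ y ∏_{p≤x} (1 − ρ(p)/p) ∑_{n≤x} v(n; F, ρ)`  (18)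
uniformly for `x ≥ c₀‖Q‖^δ` and `x^{4g²ε} ≤ y ≤ x`.  The implicit constant in the `≪`-sign depends
at most on `A, B, ε, δ, k, r, g, D` and the constant `c₀` depends at most on `A, B, ε, δ, k, r`
and `g`."  (`D := ∏_{p^ν ∥ D*, ρ(p) ≠ 0} p^ν`, `D*` the discriminant of the squarefree kernel `Q*`,
§2 p. 123.)  Rendering of `h` (identical to that of `NairTenenbaum1998_theorem1` but for the
parameter ranges; what a reviewer must accept): `c₀` and `C` are chosen after
`(k, g, D, A, B, ε, δ)` and before `Q, F, x, y` — here `D = (∏ Qⱼ).discr` (Mathlib's standard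
discriminant; `= D*` since `Q* = ±Q` for pairwise coprime irreducible `Qⱼ` of positive degree, a
prime constant `Qⱼ` being excluded by the fixed-divisor hypothesis), of which the printed `D` is
one of finitely many divisors, and `r = k`, so the printed constants may be maximised over the
finitely many data; letting `c₀` depend on `D` too is weaker than printed; "irreducible" is
`Irreducible` in `ℤ[X]`; "pairwise coprime" is `IsCoprime` of the images in `ℚ[X]`;
`‖Q‖ = polyHeight (∏ Qⱼ)`; `𝓜_k` is `IsClassMk` ((1) p. 119, coprimality `(mⱼ, nⱼ) = 1` for each
`j`); the `≤ g` integers `n` with `Q(n) = 0` are omitted from the left sum; the right-hand sum runs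
over all `nⱼ ≥ 1` with `∏ nⱼ ≤ ⌊x⌋₊` and drops the restriction `†` — all terms being `≥ 0` it
dominates `∑_{n≤x} v(n; F, ρ)`, so `h` is weaker than printed.  The general theorem (arbitrary
`Qⱼ`, `v(n; F, ρ)` through the factorisation (9) p. 123) is not rendered: `TODO(general form)`.
`h` is what a definition proposal should vendor verbatim as the named fact
`NairTenenbaum1998_theorem1_printed` (D-0026: not in an erratum written by a proving seat).
The CONCLUSION is the body of `NairTenenbaum1998_theorem1` with `α < 1` replaced by `α < 1/2`:
the range on which Henriot's paraphrase follows from the printed theorem.  Proof: apply `h` with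
`ε_NT := α/(4g²)`, which is `< 1/(8g²)` exactly when `α < 1/2`, use
`𝓜_k(A, B, ε) ⊆ 𝓜_k(A, B, ⅓ε_NT δ)` (`IsClassMk.mono`; `ε ≤ αδ/(12g²) = ⅓ε_NT δ`) and
`x^{4g²ε_NT} = x^α < y`.
[cite: NairTenenbaum1998, Theorem 1 (p. 125); (16) p. 124; §2 p. 123; Henriot2012, Thm. 1
(paraphrase; range corrected here)] -/
theorem NairTenenbaum1998_theorem1.henriotForm_of_printed
    (h : ∀ (k g : ℕ) (D : ℤ) (A B ε δ : ℝ), 1 ≤ k → 1 ≤ A → 1 ≤ B → 0 < ε →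
      ε < 1 / (8 * (g : ℝ) ^ 2) → 0 < δ → δ < 1 →
      ∃ c₀ C : ℝ, ∀ Q : Fin k → ℤ[X], (∀ j, Irreducible (Q j)) →
        (∀ i j, i ≠ j →
          IsCoprime ((Q i).map (Int.castRingHom ℚ)) ((Q j).map (Int.castRingHom ℚ))) →
        HasNoFixedPrimeDivisor Q → (∏ j, Q j).natDegree = g → (∏ j, Q j).discr = D →
        ∀ F : (Fin k → ℕ) → ℝ, IsClassMk k A B (ε * δ / 3) F →
          ∀ x y : ℝ, c₀ * (polyHeight (∏ j, Q j) : ℝ) ^ δ ≤ x → x ^ (4 * (g : ℝ) ^ 2 * ε) ≤ y →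
            y ≤ x →
            ∑ n ∈ (Finset.Ioc ⌊x⌋₊ ⌊x + y⌋₊).filter (fun n : ℕ => (∏ j, Q j).eval (n : ℤ) ≠ 0),
                F (fun j => ((Q j).eval (n : ℤ)).natAbs) ≤
              C * y * (∏ p ∈ (Finset.Icc 1 ⌊x⌋₊).filter Nat.Prime,
                  (1 - (polyRootCountMod Q p : ℝ) / p)) *
                ∑ n ∈ (Fintype.piFinset fun _ : Fin k => Finset.Icc 1 ⌊x⌋₊).filter
                    (fun n => ∏ j, n j ≤ ⌊x⌋₊),
                  F n * ∏ j, ((polyRootCountMod ![Q j] (n j) : ℝ) / (n j))) :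
    ∀ (k g : ℕ) (D : ℤ) (A B α δ ε : ℝ), 1 ≤ k → 1 ≤ A → 1 ≤ B → 0 < α → α < 1 / 2 → 0 < δ →
    δ < 1 → 0 < ε → ε ≤ α * δ / (12 * (g : ℝ) ^ 2) →
    ∃ c₀ C : ℝ, ∀ Q : Fin k → ℤ[X], (∀ j, Irreducible (Q j)) →
      (∀ i j, i ≠ j → IsCoprime ((Q i).map (Int.castRingHom ℚ)) ((Q j).map (Int.castRingHom ℚ))) →
      HasNoFixedPrimeDivisor Q → (∏ j, Q j).natDegree = g → (∏ j, Q j).discr = D →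
      ∀ F : (Fin k → ℕ) → ℝ, IsClassMk k A B ε F →
        ∀ x y : ℝ, c₀ * (polyHeight (∏ j, Q j) : ℝ) ^ δ ≤ x → x ^ α < y → y ≤ x →
          ∑ n ∈ (Finset.Ioc ⌊x⌋₊ ⌊x + y⌋₊).filter (fun n : ℕ => (∏ j, Q j).eval (n : ℤ) ≠ 0),
              F (fun j => ((Q j).eval (n : ℤ)).natAbs) ≤
            C * y * (∏ p ∈ (Finset.Icc 1 ⌊x⌋₊).filter Nat.Prime,
                (1 - (polyRootCountMod Q p : ℝ) / p)) *
              ∑ n ∈ (Fintype.piFinset fun _ : Fin k => Finset.Icc 1 ⌊x⌋₊).filter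
                  (fun n => ∏ j, n j ≤ ⌊x⌋₊),
                F n * ∏ j, ((polyRootCountMod ![Q j] (n j) : ℝ) / (n j)) := by
  intro k g D A B α δ ε hk hA hB hα hα2 hδ hδ1 hε hεα
  by_cases hg : g = 0
  · subst hg
    exact absurd (hεα.trans (by simp)) (not_le.mpr hε)
  have hg' : (0 : ℝ) < (g : ℝ) ^ 2 := by positivity
  set ε' : ℝ := α / (4 * (g : ℝ) ^ 2) with hε'_def
  have hε'0 : 0 < ε' := by positivity
  have hε'lt : ε' < 1 / (8 * (g : ℝ) ^ 2) := by
    rw [hε'_def, div_lt_div_iff₀ (by positivity) (by positivity)]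
    nlinarith
  obtain ⟨c₀, C, hC⟩ := h k g D A B ε' δ hk hA hB hε'0 hε'lt hδ hδ1
  refine ⟨c₀, C, fun Q hirr hcop hfix hdeg hdisc F hF x y hx hy hyx =>
    hC Q hirr hcop hfix hdeg hdisc F (hF.mono (by linarith) ?_) x y hx ?_ hyx⟩
  · have : ε' * δ / 3 = α * δ / (12 * (g : ℝ) ^ 2) := by
      rw [hε'_def]; field_simp; ring
    rw [this]; exact hεα
  · have : 4 * (g : ℝ) ^ 2 * ε' = α := by rw [hε'_def]; field_simp
    rw [this]; exact hy.le

/-- The old (misstated) `NairTenenbaum1998_theorem1` implies the printed Theorem 1 (the hypothesis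
of `NairTenenbaum1998_theorem1.henriotForm_of_printed`, which see for the wording and rendering)
with the STRICT lower bound `x^{4g²ε} < y` in place of `x^{4g²ε} ≤ y` (take `α := 4g²ε < 1/2 < 1`
and Henriot-`ε := ⅓εδ = αδ/(12g²)`): on the common range the two renderings agree and the old
Prop is the stronger one (the boundary `y = x^{4g²ε}` of the printed range is not reached from
the old Prop's `x^α < y`; immaterial for the erratum). [cite: NairTenenbaum1998, Theorem 1 (p. 125)] -/
theorem NairTenenbaum1998_theorem1.printedForm_strict (h : NairTenenbaum1998_theorem1) :
    ∀ (k g : ℕ) (D : ℤ) (A B ε δ : ℝ), 1 ≤ k → 1 ≤ A → 1 ≤ B → 0 < ε → ε < 1 / (8 * (g : ℝ) ^ 2) →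
    0 < δ → δ < 1 →
    ∃ c₀ C : ℝ, ∀ Q : Fin k → ℤ[X], (∀ j, Irreducible (Q j)) →
      (∀ i j, i ≠ j → IsCoprime ((Q i).map (Int.castRingHom ℚ)) ((Q j).map (Int.castRingHom ℚ))) →
      HasNoFixedPrimeDivisor Q → (∏ j, Q j).natDegree = g → (∏ j, Q j).discr = D →
      ∀ F : (Fin k → ℕ) → ℝ, IsClassMk k A B (ε * δ / 3) F →
        ∀ x y : ℝ, c₀ * (polyHeight (∏ j, Q j) : ℝ) ^ δ ≤ x → x ^ (4 * (g : ℝ) ^ 2 * ε) < y →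
          y ≤ x →
          ∑ n ∈ (Finset.Ioc ⌊x⌋₊ ⌊x + y⌋₊).filter (fun n : ℕ => (∏ j, Q j).eval (n : ℤ) ≠ 0),
              F (fun j => ((Q j).eval (n : ℤ)).natAbs) ≤
            C * y * (∏ p ∈ (Finset.Icc 1 ⌊x⌋₊).filter Nat.Prime,
                (1 - (polyRootCountMod Q p : ℝ) / p)) *
              ∑ n ∈ (Fintype.piFinset fun _ : Fin k => Finset.Icc 1 ⌊x⌋₊).filter
                  (fun n => ∏ j, n j ≤ ⌊x⌋₊),
                F n * ∏ j, ((polyRootCountMod ![Q j] (n j) : ℝ) / (n j)) := by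
  intro k g D A B ε δ hk hA hB hε hε8 hδ hδ1
  by_cases hg : g = 0
  · subst hg
    exact absurd (hε8.trans_le (by simp)) (not_lt.mpr hε.le)
  have hg' : (0 : ℝ) < (g : ℝ) ^ 2 := by positivity
  have hα1 : 4 * (g : ℝ) ^ 2 * ε < 1 := by
    rw [lt_div_iff₀ (by positivity)] at hε8
    nlinarith
  have hεH : ε * δ / 3 ≤ 4 * (g : ℝ) ^ 2 * ε * δ / (12 * (g : ℝ) ^ 2) := by
    rw [le_div_iff₀ (by positivity)]
    nlinarith
  obtain ⟨c₀, C, hC⟩ := h k g D A B (4 * (g : ℝ) ^ 2 * ε) δ (ε * δ / 3) hk hA hB (by positivity)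
    hα1 hδ hδ1 (by positivity) hεH
  exact ⟨c₀, C, hC⟩

end Literature.NumberTheory.Sieve
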